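/-
Copyright (c) 2026 the pub-hodgecm-mathlib formalisation cell (harness21).  Prover seat hodgecm-mathlib-F0P2-p02 (g13): road «S3-ram» (LEAD F0P3a-plan (g12); architect
A-p16 (g31); owner F0P3a-p06 (g15)), junction organ J0 «THE ENGINE IN THE DIAGONAL MODEL» (F0P3a-p01 (g16) HANDOFF «For the heir», step 1); 2026-09-02.
-/
import Literature.NumberTheory.Rogawski1990.DepthZeroKappaTransferTypeOneRamifiedTreeInduction   -- ★ G5 engine p847302 ∕ ED. 2 p847422 (F0P3a-p01 (g16)): the two root assemblies
import Literature.NumberTheory.Automorphic.UnitaryLatticeTreeIsTreeDiagonalRamified                -- ★ J1 p847380 (this seat): `isTree_latticeGraph_three_diagonal_of_neg`, the frame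
import Literature.NumberTheory.Automorphic.UnitaryLatticeTreeAlternationFormCongr                  -- ★ J2 p847369 (F0P3-p03 (g15)): alternation in the model `c • formCongr σ P J₀`
import Literature.NumberTheory.Automorphic.UnitaryLatticeTreeDiagonalFixedBounded                  -- ★ J4a p847368 (F0P3a-p01 (g16)): `finite_setOf_latticeGraphIso_diagonal_eq`
import Literature.NumberTheory.Automorphic.UnitaryLatticeTreeStabilizer                            -- ★ `mapGL_stdLattice_eq_iff` (the root is fixed by `GL₃(𝒪)`)
import HarnessLib

/-!
# The ramified type-(1) `κ`-orbital integral: the tree-induction ENGINE instantiated in the DIAGONAL MODEL `(K³, diag d)` of a literal — its generic binders discharged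
# (Kottwitz 1986 §3; Rogawski 1990 §4.9; Bruhat–Tits 1972 §10; Serre, *Trees* II.1.1)

Topic `NumberTheory/Rogawski1990`; namespace `Literature.NumberTheory.Rogawski1990`.  THEOREMS ONLY (no definition, no instance, no notation, no named fact, no `sorry`); kernel
lane `--supports stmt-HodgeConjecture-24833`.  Cell `pub/hodgecm-mathlib` (D-0151), crux H413; road «S3-ram» (count-neutral), P-1-ram organ A′ (ii) (a2); junction organ **J0
«THE ENGINE IN THE DIAGONAL MODEL»** = step 1 of F0P3a-p01 (g16)'s HANDOFF «For the heir»: the GENERIC rooted-tree engine ★ `DepthZeroKappaTransferTypeOneRamifiedTreeInduction`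
(`strataVec_total_eq_of_localLaw_of_root`, `…_axis_of_root`) is stated for any tree `G`, root `r`, finite parent-closed `F`, alternating predicate `SD`; here `G := latticeGraph σ ϖ
(diag d)` (the eigenframe model of a type-(1) literal `T = diag s`, `d` units, `σ dᵢ = dᵢ`), `r := L₀ = 𝒪³`, `F := Fix (latticeGraphIso T)`, `SD := IsSelfDualLattice`, and the
FIVE GENERIC HYPOTHESES ARE DISCHARGED by name: `hT` ⟸ ★ J1 `isTree_latticeGraph_three_diagonal_of_neg` (F0P2-p02); `hSD₁ hSD₂` ⟸ ★ J2 `isSelfDualLattice_iff_not_of_adj_smul_formCongr…`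
(F0P3-p03) along the ★ frame `diag d = (−det) • ᵗσ(A) J₀ A`; `hF` ⟸ ★ G1 `parentClosed_fixedPoints` (F0P2-p02); `hFfin` ⟸ ★ J4a `finite_setOf_latticeGraphIso_diagonal_eq` (F0P3a-p01);
`hrF hrS` (the root is fixed and self-dual).  Every LATTICE-SPECIFIC binder — the labels `str dep rk cl (ax)` with `hstr`, the grandchildren set `GC` with `hGC`, the local laws
`hrk … hP` (J6), the closed-form families `TE TO TP (TA)` with their recursions (★ ShellSums), the root data `hroot` (J7) — is kept VERBATIM for the heir's junction file.
Seat F0P2-p02 (g13).  HONEST LABEL: HC_CM is proved only modulo the 2 remaining named inputs (hLiu418 24832, h413 24833) until rung 0 closes; nothing printed is asserted here.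

* §1 `isSelfDualLattice_iff_not_congr` (alternation transports along an equality of forms), **`isSelfDualLattice_iff_not_isSelfDualLattice_of_adj_diagonal`** (alternation in
  the diagonal model), `not_isSelfDualLattice_of_adj_diagonal` ∕ `isSelfDualLattice_of_adj_of_not_diagonal` (the engine's `hSD₁` ∕ `hSD₂` shapes).
* §2 `latticeGraphIso_eq_iff_mapGL_eq'`, `mapGL_diagonal_stdLattice` (a unit diagonal `T` fixes `L₀`), `latticeGraphIso_diagonal_root_eq` (the root vertex is fixed),
  `parentClosed_setOf_latticeGraphIso_diagonal_eq` (the engine's `hF`), `isSelfDualLattice_root_diagonal` (`hrS`).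
* §3 **`strataVec_total_eq_of_localLaw_of_root_diagonal`**, **`strataVec_total_eq_of_localLaw_axis_of_root_diagonal`** — the two ★ root assemblies with `G, r, F, SD`
  instantiated and `hT hFfin hF hSD₁ hSD₂ hrF hrS` discharged.

## References
* [Kottwitz1986] R. E. Kottwitz, *Base change for unit elements of Hecke algebras*, Compositio Math. 60 (1986), §3 (counting fixed lattices).
* [Rogawski1990] J. D. Rogawski, *Automorphic Representations of Unitary Groups in Three Variables*, Ann. of Math. Stud. 123 (1990), §4.9 pp. 54–56.
* [BruhatTits1972] F. Bruhat, J. Tits, *Groupes réductifs sur un corps local I*, Publ. Math. IHÉS 41 (1972), §10.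
* [Serre1980Trees] J.-P. Serre, *Trees* (1980), I.2.3, II.1.1.
-/

set_option autoImplicit false

noncomputable section

open scoped Valued WithZero Matrix MatrixGroups
open SimpleGraph
open Literature.Combinatorics.SimpleGraph.TreeLayers
open Literature.NumberTheory.Automorphic Literature.NumberTheory.Automorphic.HermitianLattice Literature.NumberTheory.Automorphic.UnitaryLatticeTree

namespace Literature.NumberTheory.Rogawski1990

variable {K : Type*} [Field K] [Valued K ℤᵐ⁰] {σ : K →+* K} {ϖ : K}

/-! ## §1 Alternation of self-duality along edges in the diagonal model (the engine's `hSD₁`, `hSD₂`) -/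

/-- Alternation of self-duality along edges transports along an equality of forms `H = H′` (the vertex type depends on the form). [cite: BruhatTits1972, §10] -/
theorem isSelfDualLattice_iff_not_congr {N : ℕ} {H H' : Matrix (Fin N) (Fin N) K} (h : H = H')
    (halt : ∀ v w : {M : Submodule 𝒪[K] (Fin N → K) // IsVertex σ ϖ H' M}, (latticeGraph σ ϖ H').Adj v w →
      (IsSelfDualLattice σ ϖ H' v.1 ↔ ¬ IsSelfDualLattice σ ϖ H' w.1))
    (v w : {M : Submodule 𝒪[K] (Fin N → K) // IsVertex σ ϖ H M}) (hvw : (latticeGraph σ ϖ H).Adj v w) :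
    IsSelfDualLattice σ ϖ H v.1 ↔ ¬ IsSelfDualLattice σ ϖ H w.1 := by
  subst h
  exact halt v w hvw

/-- **Self-duality ALTERNATES along the edges of the diagonal-model tree** `latticeGraph σ ϖ (diag d)` (`d` units, `σ dᵢ = dᵢ`, tamely ramified datum with a finite residue
field): ★ J2 `isSelfDualLattice_iff_not_isSelfDualLattice_of_adj_smul_formCongr_antidiagonal` in the model `(−det) • ᵗσ(A) J₀ A`, transported along the ★ J1 frame
`exists_glInt_diagonal_eq_smul_formCongr_antidiagonal`. [cite: BruhatTits1972, §10] [cite: Serre1980Trees, II.1.1] -/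
theorem isSelfDualLattice_iff_not_isSelfDualLattice_of_adj_diagonal [Finite 𝓀[K]] (hσ : ∀ x, σ (σ x) = x) (hvσ : ∀ a, Valued.v (σ a) = Valued.v a)
    (hϖ : Valued.v ϖ = WithZero.exp (-1 : ℤ)) (hres : ∀ x : K, Valued.v x ≤ 1 → Valued.v (σ x - x) < 1) (h2 : Valued.v (2 : K) = 1)
    (hnorm : ∀ u : K, σ u = u → Valued.v (u - 1) < 1 → ∃ z : K, z * σ z = u ∧ Valued.v (z - 1) ≤ Valued.v (u - 1))
    (d : Fin 3 → K) (hd : ∀ i, Valued.v (d i) = 1) (hdσ : ∀ i, σ (d i) = d i)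
    {v w : {M : Submodule 𝒪[K] (Fin 3 → K) // IsVertex σ ϖ (Matrix.diagonal d) M}} (h : (latticeGraph σ ϖ (Matrix.diagonal d)).Adj v w) :
    IsSelfDualLattice σ ϖ (Matrix.diagonal d) v.1 ↔ ¬ IsSelfDualLattice σ ϖ (Matrix.diagonal d) w.1 := by
  obtain ⟨A, -, -, hA⟩ := exists_glInt_diagonal_eq_smul_formCongr_antidiagonal hσ hvσ hres h2 hnorm d hd hdσ
  have hc : Valued.v (-(Matrix.diagonal d).det) = 1 := by rw [Valuation.map_neg, v_det_diagonal_of_v_eq_one d hd]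
  exact isSelfDualLattice_iff_not_congr hA
    (fun v w hvw => isSelfDualLattice_iff_not_isSelfDualLattice_of_adj_smul_formCongr_antidiagonal hvσ hϖ hc A hvw) v w h

/-- The engine's `hSD₁` in the diagonal model: a neighbour of a self-dual vertex is not self-dual. [cite: BruhatTits1972, §10] [cite: Serre1980Trees, II.1.1] -/
theorem not_isSelfDualLattice_of_adj_diagonal [Finite 𝓀[K]] (hσ : ∀ x, σ (σ x) = x) (hvσ : ∀ a, Valued.v (σ a) = Valued.v a)
    (hϖ : Valued.v ϖ = WithZero.exp (-1 : ℤ)) (hres : ∀ x : K, Valued.v x ≤ 1 → Valued.v (σ x - x) < 1) (h2 : Valued.v (2 : K) = 1)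
    (hnorm : ∀ u : K, σ u = u → Valued.v (u - 1) < 1 → ∃ z : K, z * σ z = u ∧ Valued.v (z - 1) ≤ Valued.v (u - 1))
    (d : Fin 3 → K) (hd : ∀ i, Valued.v (d i) = 1) (hdσ : ∀ i, σ (d i) = d i)
    (v c : {M : Submodule 𝒪[K] (Fin 3 → K) // IsVertex σ ϖ (Matrix.diagonal d) M}) (h : (latticeGraph σ ϖ (Matrix.diagonal d)).Adj v c)
    (hv : IsSelfDualLattice σ ϖ (Matrix.diagonal d) v.1) : ¬ IsSelfDualLattice σ ϖ (Matrix.diagonal d) c.1 :=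
  (isSelfDualLattice_iff_not_isSelfDualLattice_of_adj_diagonal hσ hvσ hϖ hres h2 hnorm d hd hdσ h).1 hv

/-- The engine's `hSD₂` in the diagonal model: a neighbour of a non-self-dual vertex is self-dual. [cite: BruhatTits1972, §10] [cite: Serre1980Trees, II.1.1] -/
theorem isSelfDualLattice_of_adj_of_not_diagonal [Finite 𝓀[K]] (hσ : ∀ x, σ (σ x) = x) (hvσ : ∀ a, Valued.v (σ a) = Valued.v a)
    (hϖ : Valued.v ϖ = WithZero.exp (-1 : ℤ)) (hres : ∀ x : K, Valued.v x ≤ 1 → Valued.v (σ x - x) < 1) (h2 : Valued.v (2 : K) = 1)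
    (hnorm : ∀ u : K, σ u = u → Valued.v (u - 1) < 1 → ∃ z : K, z * σ z = u ∧ Valued.v (z - 1) ≤ Valued.v (u - 1))
    (d : Fin 3 → K) (hd : ∀ i, Valued.v (d i) = 1) (hdσ : ∀ i, σ (d i) = d i)
    (c w : {M : Submodule 𝒪[K] (Fin 3 → K) // IsVertex σ ϖ (Matrix.diagonal d) M}) (h : (latticeGraph σ ϖ (Matrix.diagonal d)).Adj c w)
    (hc : ¬ IsSelfDualLattice σ ϖ (Matrix.diagonal d) c.1) : IsSelfDualLattice σ ϖ (Matrix.diagonal d) w.1 :=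
  (isSelfDualLattice_iff_not_isSelfDualLattice_of_adj_diagonal hσ hvσ hϖ hres h2 hnorm d hd hdσ h.symm).2 hc

/-! ## §2 The root `L₀` and the fixed set `Fix T` of a unit diagonal `T` (the engine's `hF`, `hFfin`, `hrF`, `hrS`) -/

/-- Vertex ∕ lattice spelling of fixedness: `latticeGraphIso u v = v ↔ u·v.1 = v.1`. [cite: BruhatTits1972, §10] -/
theorem latticeGraphIso_eq_iff_mapGL_eq' {N : ℕ} {H : Matrix (Fin N) (Fin N) K} (u : unitaryGroupOfForm σ H)
    (v : {M : Submodule 𝒪[K] (Fin N → K) // IsVertex σ ϖ H M}) :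
    latticeGraphIso σ ϖ H u v = v ↔ mapGL (u : GL (Fin N) K) v.1 = v.1 := by
  rw [← Subtype.coe_inj, latticeGraphIso_apply_coe]
  rfl

/-- **A unit diagonal matrix fixes the root**: `diag(s)·𝒪^N = 𝒪^N` for `|s l| = 1`. [cite: Serre1980Trees, II.1.1] -/
theorem mapGL_diagonal_stdLattice {N : ℕ} (T : GL (Fin N) K) {s : Fin N → K} (hT : (T : Matrix (Fin N) (Fin N) K) = Matrix.diagonal s)
    (hs : ∀ l, Valued.v (s l) = 1) : mapGL T (stdLattice K N) = stdLattice K N := by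
  have hs0 : ∀ l, s l ≠ 0 := fun l h0 => by have := hs l; rw [h0, map_zero] at this; exact zero_ne_one this
  have hTinv : ((T⁻¹ : GL (Fin N) K) : Matrix (Fin N) (Fin N) K) = Matrix.diagonal fun l => (s l)⁻¹ := by
    have h : (T : Matrix (Fin N) (Fin N) K) * Matrix.diagonal (fun l => (s l)⁻¹) = 1 := by
      rw [hT, Matrix.diagonal_mul_diagonal]
      convert Matrix.diagonal_one with l
      exact mul_inv_cancel₀ (hs0 l)
    calc ((T⁻¹ : GL (Fin N) K) : Matrix (Fin N) (Fin N) K)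
        = ((T⁻¹ : GL (Fin N) K) : Matrix (Fin N) (Fin N) K) * ((T : Matrix (Fin N) (Fin N) K) * Matrix.diagonal fun l => (s l)⁻¹) := by rw [h, Matrix.mul_one]
      _ = Matrix.diagonal fun l => (s l)⁻¹ := by rw [← Matrix.mul_assoc, ← Units.val_mul, inv_mul_cancel, Units.val_one, Matrix.one_mul]
  refine (mapGL_stdLattice_eq_iff T).2 ⟨?_, ?_⟩
  · intro i j
    rw [hT]
    by_cases h : i = j
    · subst h; rw [Matrix.diagonal_apply_eq]; exact (hs i).le
    · rw [Matrix.diagonal_apply_ne _ h, map_zero]; exact zero_le_one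
  · intro i j
    rw [hTinv]
    by_cases h : i = j
    · subst h; rw [Matrix.diagonal_apply_eq, map_inv₀, hs i, inv_one]
    · rw [Matrix.diagonal_apply_ne _ h, map_zero]; exact zero_le_one

/-- **The root vertex is fixed** by a unit diagonal `T ∈ U(σ, diag d)`. [cite: BruhatTits1972, §10] [cite: Serre1980Trees, II.1.1] -/
theorem latticeGraphIso_diagonal_root_eq {d : Fin 3 → K} (T : unitaryGroupOfForm σ (Matrix.diagonal d)) {s : Fin 3 → K}
    (hT : ((T : GL (Fin 3) K) : Matrix (Fin 3) (Fin 3) K) = Matrix.diagonal s) (hs : ∀ l, Valued.v (s l) = 1)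
    (r : {M : Submodule 𝒪[K] (Fin 3 → K) // IsVertex σ ϖ (Matrix.diagonal d) M}) (hr : r.1 = stdLattice K 3) :
    latticeGraphIso σ ϖ (Matrix.diagonal d) T r = r := by
  rw [latticeGraphIso_eq_iff_mapGL_eq', hr]
  exact mapGL_diagonal_stdLattice (T : GL (Fin 3) K) hT hs

/-- **The fixed set of a unit diagonal `T` is parent-closed towards the root** (the engine's `hF`): ★ G1 `parentClosed_fixedPoints` at `φ := latticeGraphIso T`, which fixes `L₀`.
[cite: Serre1980Trees, I.2.3] [cite: BruhatTits1972, §10] -/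
theorem parentClosed_setOf_latticeGraphIso_diagonal_eq {d : Fin 3 → K} (hTree : (latticeGraph σ ϖ (Matrix.diagonal d)).IsTree)
    (T : unitaryGroupOfForm σ (Matrix.diagonal d)) {s : Fin 3 → K} (hT : ((T : GL (Fin 3) K) : Matrix (Fin 3) (Fin 3) K) = Matrix.diagonal s) (hs : ∀ l, Valued.v (s l) = 1)
    (r : {M : Submodule 𝒪[K] (Fin 3 → K) // IsVertex σ ϖ (Matrix.diagonal d) M}) (hr : r.1 = stdLattice K 3) :
    ∀ w ∈ {v | latticeGraphIso σ ϖ (Matrix.diagonal d) T v = v}, w ≠ r → ∀ u, (latticeGraph σ ϖ (Matrix.diagonal d)).Adj w u →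
      (latticeGraph σ ϖ (Matrix.diagonal d)).dist r u + 1 = (latticeGraph σ ϖ (Matrix.diagonal d)).dist r w → u ∈ {v | latticeGraphIso σ ϖ (Matrix.diagonal d) T v = v} :=
  parentClosed_fixedPoints hTree r (latticeGraphIso σ ϖ (Matrix.diagonal d) T) (latticeGraphIso_diagonal_root_eq T hT hs r hr)

/-- The root `L₀` is self-dual for `diag d` (the engine's `hrS`; ★ `isSelfDualLattice_stdLattice_diagonal`). [cite: BruhatTits1972, §10] -/
theorem isSelfDualLattice_root_diagonal (hϖ : Valued.v ϖ = WithZero.exp (-1 : ℤ)) {d : Fin 3 → K} (hd : ∀ i, Valued.v (d i) = 1)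
    (r : {M : Submodule 𝒪[K] (Fin 3 → K) // IsVertex σ ϖ (Matrix.diagonal d) M}) (hr : r.1 = stdLattice K 3) :
    IsSelfDualLattice σ ϖ (Matrix.diagonal d) r.1 := by
  have hϖ1 : Valued.v ϖ ≤ 1 := by rw [hϖ, ← WithZero.exp_zero]; exact WithZero.exp_le_exp.2 (by norm_num)
  rw [hr]
  exact isSelfDualLattice_stdLattice_diagonal σ hϖ1 hd

/-! ## §3 The two root assemblies of the engine, in the diagonal model -/

section Engine

variable [ValuativeRel K] [(Valued.v : Valuation K ℤᵐ⁰).Compatible] [Finite 𝓀[K]]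

/-- **THE ROOT ASSEMBLY IN THE DIAGONAL MODEL** (★ `strataVec_total_eq_of_localLaw_of_root` with `G := latticeGraph σ ϖ (diag d)`, `r := L₀`, `F := Fix T`,
`SD := IsSelfDualLattice`, and `hT hFfin hF hSD₁ hSD₂ hrF hrS` DISCHARGED; `T = diag s` a unit diagonal element of `U(σ, diag d)` with regular residues witnessed by `δ`).
All label ∕ local-law ∕ closed-form ∕ root-data binders are the engine's, verbatim. [cite: Kottwitz1986, §3] [cite: Rogawski1990, §4.9 pp. 54–56] [cite: BruhatTits1972, §10] -/
theorem strataVec_total_eq_of_localLaw_of_root_diagonal (hσ : ∀ x, σ (σ x) = x) (hvσ : ∀ a, Valued.v (σ a) = Valued.v a)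
    (hϖ : Valued.v ϖ = WithZero.exp (-1 : ℤ)) (hσϖ : σ ϖ = -ϖ) (hres : ∀ x : K, Valued.v x ≤ 1 → Valued.v (σ x - x) < 1) (h2 : Valued.v (2 : K) = 1)
    (hnorm : ∀ u : K, σ u = u → Valued.v (u - 1) < 1 → ∃ z : K, z * σ z = u ∧ Valued.v (z - 1) ≤ Valued.v (u - 1))
    (d : Fin 3 → K) (hd : ∀ i, Valued.v (d i) = 1) (hdσ : ∀ i, σ (d i) = d i)
    {s : Fin 3 → K} (hs : ∀ l, Valued.v (s l) = 1) {δ : K} (hδ0 : δ ≠ 0)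
    (hδ : ∀ i j k : Fin 3, i ≠ j → i ≠ k → j ≠ k → Valued.v δ ≤ Valued.v ((s i - s j) * (s i - s k)))
    (T : unitaryGroupOfForm σ (Matrix.diagonal d)) (hT : ((T : GL (Fin 3) K) : Matrix (Fin 3) (Fin 3) K) = Matrix.diagonal s)
    (r : {M : Submodule 𝒪[K] (Fin 3 → K) // IsVertex σ ϖ (Matrix.diagonal d) M}) (hr : r.1 = stdLattice K 3)
    (str : Fin 5 → {M : Submodule 𝒪[K] (Fin 3 → K) // IsVertex σ ϖ (Matrix.diagonal d) M} → Prop) [∀ j, DecidablePred (str j)]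
    (dep rk : {M : Submodule 𝒪[K] (Fin 3 → K) // IsVertex σ ϖ (Matrix.diagonal d) M} → ℕ)
    (cl : {M : Submodule 𝒪[K] (Fin 3 → K) // IsVertex σ ϖ (Matrix.diagonal d) M} → ℤ)
    (hstr : ∀ w ∈ {v | latticeGraphIso σ ϖ (Matrix.diagonal d) T v = v}, IsSelfDualLattice σ ϖ (Matrix.diagonal d) w.1 →
      (str 0 w ↔ dep w = 0) ∧ (str 1 w ↔ dep w = 1 ∧ rk w = 2) ∧ (str 2 w ↔ dep w = 1 ∧ rk w = 1 ∧ cl w = 1) ∧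
      (str 3 w ↔ dep w = 1 ∧ rk w = 1 ∧ cl w = -1) ∧ (str 4 w ↔ 2 ≤ dep w))
    (GC : {M : Submodule 𝒪[K] (Fin 3 → K) // IsVertex σ ϖ (Matrix.diagonal d) M} → Set {M : Submodule 𝒪[K] (Fin 3 → K) // IsVertex σ ϖ (Matrix.diagonal d) M})
    (hGC : ∀ v w, w ∈ GC v ↔ ∃ c, ((latticeGraph σ ϖ (Matrix.diagonal d)).Adj v c ∧
      (latticeGraph σ ϖ (Matrix.diagonal d)).dist r c = (latticeGraph σ ϖ (Matrix.diagonal d)).dist r v + 1 ∧ latticeGraphIso σ ϖ (Matrix.diagonal d) T c = c) ∧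
      ((latticeGraph σ ϖ (Matrix.diagonal d)).Adj c w ∧ (latticeGraph σ ϖ (Matrix.diagonal d)).dist r w = (latticeGraph σ ϖ (Matrix.diagonal d)).dist r c + 1 ∧
        latticeGraphIso σ ϖ (Matrix.diagonal d) T w = w))
    (q : ℕ) (sgn : ℤ)
    (hrk : ∀ v ∈ {v | latticeGraphIso σ ϖ (Matrix.diagonal d) T v = v}, IsSelfDualLattice σ ϖ (Matrix.diagonal d) v.1 → v ≠ r → 1 ≤ dep v → rk v = 1 ∨ rk v = 2)
    (hcl : ∀ v ∈ {v | latticeGraphIso σ ϖ (Matrix.diagonal d) T v = v}, IsSelfDualLattice σ ϖ (Matrix.diagonal d) v.1 → v ≠ r → rk v = 1 → cl v = 1 ∨ cl v = -1)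
    (hodd : ∀ v ∈ {v | latticeGraphIso σ ϖ (Matrix.diagonal d) T v = v}, IsSelfDualLattice σ ϖ (Matrix.diagonal d) v.1 → v ≠ r → 2 ≤ dep v → rk v = 1 → Odd (dep v))
    (hB : ∀ v ∈ {v | latticeGraphIso σ ϖ (Matrix.diagonal d) T v = v}, IsSelfDualLattice σ ϖ (Matrix.diagonal d) v.1 → v ≠ r → dep v = 0 → GC v = ∅)
    (hC : ∀ v ∈ {v | latticeGraphIso σ ϖ (Matrix.diagonal d) T v = v}, IsSelfDualLattice σ ϖ (Matrix.diagonal d) v.1 → v ≠ r → dep v = 1 → rk v = 1 → GC v = ∅)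
    (hR : ∀ v ∈ {v | latticeGraphIso σ ϖ (Matrix.diagonal d) T v = v}, IsSelfDualLattice σ ϖ (Matrix.diagonal d) v.1 → v ≠ r → dep v = 1 → rk v = 2 →
      (∀ w ∈ GC v, dep w = 0) ∧ (GC v).ncard = q)
    (hE : ∀ v ∈ {v | latticeGraphIso σ ϖ (Matrix.diagonal d) T v = v}, IsSelfDualLattice σ ϖ (Matrix.diagonal d) v.1 → v ≠ r → ∀ m, dep v = 2 * m + 2 → rk v = 2 →
      (∀ w ∈ GC v, dep w = 2 * m + 1 ∧ rk w = 2) ∧ (GC v).ncard = q ^ 2)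
    (hO : ∀ v ∈ {v | latticeGraphIso σ ϖ (Matrix.diagonal d) T v = v}, IsSelfDualLattice σ ϖ (Matrix.diagonal d) v.1 → v ≠ r → ∀ m, dep v = 2 * m + 3 → rk v = 2 →
      (∀ w ∈ GC v, (dep w = 2 * m + 2 ∧ rk w = 2) ∨ (dep w = 2 * m + 1 ∧ rk w = 1 ∧ (cl w = 1 ∨ cl w = -1))) ∧
        {w | w ∈ GC v ∧ dep w = 2 * m + 2}.ncard = q ∧ {w | w ∈ GC v ∧ dep w = 2 * m + 1 ∧ cl w = 1}.ncard = q.choose 2 ∧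
          {w | w ∈ GC v ∧ dep w = 2 * m + 1 ∧ cl w = -1}.ncard = q.choose 2)
    (hP : ∀ v ∈ {v | latticeGraphIso σ ϖ (Matrix.diagonal d) T v = v}, IsSelfDualLattice σ ϖ (Matrix.diagonal d) v.1 → v ≠ r → ∀ m (c : ℤ), dep v = 2 * m + 3 → rk v = 1 →
      cl v = c → (∀ w ∈ GC v, dep w = 2 * m + 1 ∧ rk w = 1 ∧ cl w = sgn * c) ∧ (GC v).ncard = q ^ 2)
    (TE TO : ℕ → Fin 5 → ℕ) (TP : ℤ → ℕ → Fin 5 → ℕ)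
    (hTE : ∀ m, TE (m + 1) = ![0, 0, 0, 0, 1] + q ^ 2 • TO m)
    (hTO0 : TO 0 = ![0, 1, 0, 0, 0] + q • ![1, 0, 0, 0, 0])
    (hTOs : ∀ m, TO (m + 1) = ![0, 0, 0, 0, 1] + q • TE (m + 1) + q.choose 2 • (TP 1 m + TP (-1) m))
    (hTP0 : TP 1 0 = ![0, 0, 1, 0, 0]) (hTP0' : TP (-1) 0 = ![0, 0, 0, 1, 0])
    (hTPs : ∀ m (c : ℤ), c = 1 ∨ c = -1 → TP c (m + 1) = ![0, 0, 0, 0, 1] + q ^ 2 • TP (sgn * c) m)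
    (hrdep : 2 ≤ dep r) (k NE NP NM : ℕ)
    (hroot : (∀ w ∈ GC r, (dep w = 2 * k + 2 ∧ rk w = 2) ∨ (dep w = 2 * k + 1 ∧ rk w = 1 ∧ (cl w = 1 ∨ cl w = -1))) ∧
      {w | w ∈ GC r ∧ dep w = 2 * k + 2}.ncard = NE ∧ {w | w ∈ GC r ∧ dep w = 2 * k + 1 ∧ cl w = 1}.ncard = NP ∧
        {w | w ∈ GC r ∧ dep w = 2 * k + 1 ∧ cl w = -1}.ncard = NM) :
    (fun j => ({v | latticeGraphIso σ ϖ (Matrix.diagonal d) T v = v} ∩ {w | IsSelfDualLattice σ ϖ (Matrix.diagonal d) w.1 ∧ str j w}).ncard) =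
      ![0, 0, 0, 0, 1] + NE • TE (k + 1) + NP • TP 1 k + NM • TP (-1) k := by
  classical
  have hTree := isTree_latticeGraph_three_diagonal_of_neg hσ hvσ hϖ hσϖ hres h2 hnorm d hd hdσ
  exact strataVec_total_eq_of_localLaw_of_root hTree r {v | latticeGraphIso σ ϖ (Matrix.diagonal d) T v = v}
    (finite_setOf_latticeGraphIso_diagonal_eq hvσ hϖ hd (fun l => (hs l).le) hδ0 hδ T hT)
    (parentClosed_setOf_latticeGraphIso_diagonal_eq hTree T hT hs r hr) (fun v => IsSelfDualLattice σ ϖ (Matrix.diagonal d) v.1) str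
    (fun v c hvc hv => not_isSelfDualLattice_of_adj_diagonal hσ hvσ hϖ hres h2 hnorm d hd hdσ v c hvc hv)
    (fun c w hcw hc => isSelfDualLattice_of_adj_of_not_diagonal hσ hvσ hϖ hres h2 hnorm d hd hdσ c w hcw hc)
    dep rk cl hstr GC hGC q sgn hrk hcl hodd hB hC hR hE hO hP TE TO TP hTE hTO0 hTOs hTP0 hTP0' hTPs
    (latticeGraphIso_diagonal_root_eq T hT hs r hr) (isSelfDualLattice_root_diagonal hϖ hd r hr) hrdep k NE NP NM hroot

/-- **THE ROOT ASSEMBLY WITH THE AXIS FAMILY, IN THE DIAGONAL MODEL** (★ ED. 2 `strataVec_total_eq_of_localLaw_axis_of_root`, same instantiation and discharges; the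
isoceles configuration). [cite: Kottwitz1986, §3] [cite: Rogawski1990, §4.9 pp. 54–56] [cite: BruhatTits1972, §10] -/
theorem strataVec_total_eq_of_localLaw_axis_of_root_diagonal (hσ : ∀ x, σ (σ x) = x) (hvσ : ∀ a, Valued.v (σ a) = Valued.v a)
    (hϖ : Valued.v ϖ = WithZero.exp (-1 : ℤ)) (hσϖ : σ ϖ = -ϖ) (hres : ∀ x : K, Valued.v x ≤ 1 → Valued.v (σ x - x) < 1) (h2 : Valued.v (2 : K) = 1)
    (hnorm : ∀ u : K, σ u = u → Valued.v (u - 1) < 1 → ∃ z : K, z * σ z = u ∧ Valued.v (z - 1) ≤ Valued.v (u - 1))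
    (d : Fin 3 → K) (hd : ∀ i, Valued.v (d i) = 1) (hdσ : ∀ i, σ (d i) = d i)
    {s : Fin 3 → K} (hs : ∀ l, Valued.v (s l) = 1) {δ : K} (hδ0 : δ ≠ 0)
    (hδ : ∀ i j k : Fin 3, i ≠ j → i ≠ k → j ≠ k → Valued.v δ ≤ Valued.v ((s i - s j) * (s i - s k)))
    (T : unitaryGroupOfForm σ (Matrix.diagonal d)) (hT : ((T : GL (Fin 3) K) : Matrix (Fin 3) (Fin 3) K) = Matrix.diagonal s)
    (r : {M : Submodule 𝒪[K] (Fin 3 → K) // IsVertex σ ϖ (Matrix.diagonal d) M}) (hr : r.1 = stdLattice K 3)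
    (str : Fin 5 → {M : Submodule 𝒪[K] (Fin 3 → K) // IsVertex σ ϖ (Matrix.diagonal d) M} → Prop) [∀ j, DecidablePred (str j)]
    (dep rk ax : {M : Submodule 𝒪[K] (Fin 3 → K) // IsVertex σ ϖ (Matrix.diagonal d) M} → ℕ)
    (cl : {M : Submodule 𝒪[K] (Fin 3 → K) // IsVertex σ ϖ (Matrix.diagonal d) M} → ℤ)
    (hstr : ∀ w ∈ {v | latticeGraphIso σ ϖ (Matrix.diagonal d) T v = v}, IsSelfDualLattice σ ϖ (Matrix.diagonal d) w.1 →
      (str 0 w ↔ dep w = 0) ∧ (str 1 w ↔ dep w = 1 ∧ rk w = 2) ∧ (str 2 w ↔ dep w = 1 ∧ rk w = 1 ∧ cl w = 1) ∧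
      (str 3 w ↔ dep w = 1 ∧ rk w = 1 ∧ cl w = -1) ∧ (str 4 w ↔ 2 ≤ dep w))
    (GC : {M : Submodule 𝒪[K] (Fin 3 → K) // IsVertex σ ϖ (Matrix.diagonal d) M} → Set {M : Submodule 𝒪[K] (Fin 3 → K) // IsVertex σ ϖ (Matrix.diagonal d) M})
    (hGC : ∀ v w, w ∈ GC v ↔ ∃ c, ((latticeGraph σ ϖ (Matrix.diagonal d)).Adj v c ∧
      (latticeGraph σ ϖ (Matrix.diagonal d)).dist r c = (latticeGraph σ ϖ (Matrix.diagonal d)).dist r v + 1 ∧ latticeGraphIso σ ϖ (Matrix.diagonal d) T c = c) ∧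
      ((latticeGraph σ ϖ (Matrix.diagonal d)).Adj c w ∧ (latticeGraph σ ϖ (Matrix.diagonal d)).dist r w = (latticeGraph σ ϖ (Matrix.diagonal d)).dist r c + 1 ∧
        latticeGraphIso σ ϖ (Matrix.diagonal d) T w = w))
    (q : ℕ) (sgn : ℤ)
    (hrk : ∀ v ∈ {v | latticeGraphIso σ ϖ (Matrix.diagonal d) T v = v}, IsSelfDualLattice σ ϖ (Matrix.diagonal d) v.1 → v ≠ r → 1 ≤ dep v →
      rk v = 1 ∨ rk v = 2 ∨ rk v = 3)
    (hcl : ∀ v ∈ {v | latticeGraphIso σ ϖ (Matrix.diagonal d) T v = v}, IsSelfDualLattice σ ϖ (Matrix.diagonal d) v.1 → v ≠ r → rk v = 1 → cl v = 1 ∨ cl v = -1)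
    (hodd : ∀ v ∈ {v | latticeGraphIso σ ϖ (Matrix.diagonal d) T v = v}, IsSelfDualLattice σ ϖ (Matrix.diagonal d) v.1 → v ≠ r → 2 ≤ dep v → rk v = 1 → Odd (dep v))
    (hAdep : ∀ v ∈ {v | latticeGraphIso σ ϖ (Matrix.diagonal d) T v = v}, IsSelfDualLattice σ ϖ (Matrix.diagonal d) v.1 → v ≠ r → rk v = 3 → 2 ≤ dep v)
    (hB : ∀ v ∈ {v | latticeGraphIso σ ϖ (Matrix.diagonal d) T v = v}, IsSelfDualLattice σ ϖ (Matrix.diagonal d) v.1 → v ≠ r → dep v = 0 → GC v = ∅)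
    (hC : ∀ v ∈ {v | latticeGraphIso σ ϖ (Matrix.diagonal d) T v = v}, IsSelfDualLattice σ ϖ (Matrix.diagonal d) v.1 → v ≠ r → dep v = 1 → rk v = 1 → GC v = ∅)
    (hR : ∀ v ∈ {v | latticeGraphIso σ ϖ (Matrix.diagonal d) T v = v}, IsSelfDualLattice σ ϖ (Matrix.diagonal d) v.1 → v ≠ r → dep v = 1 → rk v = 2 →
      (∀ w ∈ GC v, dep w = 0) ∧ (GC v).ncard = q)
    (hE : ∀ v ∈ {v | latticeGraphIso σ ϖ (Matrix.diagonal d) T v = v}, IsSelfDualLattice σ ϖ (Matrix.diagonal d) v.1 → v ≠ r → ∀ m, dep v = 2 * m + 2 → rk v = 2 →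
      (∀ w ∈ GC v, dep w = 2 * m + 1 ∧ rk w = 2) ∧ (GC v).ncard = q ^ 2)
    (hO : ∀ v ∈ {v | latticeGraphIso σ ϖ (Matrix.diagonal d) T v = v}, IsSelfDualLattice σ ϖ (Matrix.diagonal d) v.1 → v ≠ r → ∀ m, dep v = 2 * m + 3 → rk v = 2 →
      (∀ w ∈ GC v, (dep w = 2 * m + 2 ∧ rk w = 2) ∨ (dep w = 2 * m + 1 ∧ rk w = 1 ∧ (cl w = 1 ∨ cl w = -1))) ∧
        {w | w ∈ GC v ∧ dep w = 2 * m + 2}.ncard = q ∧ {w | w ∈ GC v ∧ dep w = 2 * m + 1 ∧ cl w = 1}.ncard = q.choose 2 ∧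
          {w | w ∈ GC v ∧ dep w = 2 * m + 1 ∧ cl w = -1}.ncard = q.choose 2)
    (hP : ∀ v ∈ {v | latticeGraphIso σ ϖ (Matrix.diagonal d) T v = v}, IsSelfDualLattice σ ϖ (Matrix.diagonal d) v.1 → v ≠ r → ∀ m (c : ℤ), dep v = 2 * m + 3 → rk v = 1 →
      cl v = c → (∀ w ∈ GC v, dep w = 2 * m + 1 ∧ rk w = 1 ∧ cl w = sgn * c) ∧ (GC v).ncard = q ^ 2)
    (mA qA qP NE₀ NP₀ NM₀ : ℕ) (cR : ℤ)
    (hAs : ∀ v ∈ {v | latticeGraphIso σ ϖ (Matrix.diagonal d) T v = v}, IsSelfDualLattice σ ϖ (Matrix.diagonal d) v.1 → v ≠ r → rk v = 3 → ∀ j, ax v = j + 1 →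
      (∀ w ∈ GC v, (rk w = 3 ∧ ax w = j ∧ 1 ≤ dep w) ∨ (dep w = 2 * mA + 1 ∧ rk w = 1 ∧ cl w = cR)) ∧
        {w | w ∈ GC v ∧ rk w = 3}.ncard = qA ∧ {w | w ∈ GC v ∧ rk w = 1}.ncard = qP)
    (hA0 : ∀ v ∈ {v | latticeGraphIso σ ϖ (Matrix.diagonal d) T v = v}, IsSelfDualLattice σ ϖ (Matrix.diagonal d) v.1 → v ≠ r → rk v = 3 → ax v = 0 →
      (∀ w ∈ GC v, (dep w = 2 * mA + 2 ∧ rk w = 2) ∨ (dep w = 2 * mA + 1 ∧ rk w = 1 ∧ (cl w = 1 ∨ cl w = -1))) ∧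
        {w | w ∈ GC v ∧ dep w = 2 * mA + 2}.ncard = NE₀ ∧ {w | w ∈ GC v ∧ dep w = 2 * mA + 1 ∧ cl w = 1}.ncard = NP₀ ∧
          {w | w ∈ GC v ∧ dep w = 2 * mA + 1 ∧ cl w = -1}.ncard = NM₀)
    (TE TO TA : ℕ → Fin 5 → ℕ) (TP : ℤ → ℕ → Fin 5 → ℕ)
    (hTE : ∀ m, TE (m + 1) = ![0, 0, 0, 0, 1] + q ^ 2 • TO m)
    (hTO0 : TO 0 = ![0, 1, 0, 0, 0] + q • ![1, 0, 0, 0, 0])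
    (hTOs : ∀ m, TO (m + 1) = ![0, 0, 0, 0, 1] + q • TE (m + 1) + q.choose 2 • (TP 1 m + TP (-1) m))
    (hTP0 : TP 1 0 = ![0, 0, 1, 0, 0]) (hTP0' : TP (-1) 0 = ![0, 0, 0, 1, 0])
    (hTPs : ∀ m (c : ℤ), c = 1 ∨ c = -1 → TP c (m + 1) = ![0, 0, 0, 0, 1] + q ^ 2 • TP (sgn * c) m)
    (hTA0 : TA 0 = ![0, 0, 0, 0, 1] + NE₀ • TE (mA + 1) + NP₀ • TP 1 mA + NM₀ • TP (-1) mA)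
    (hTAs : ∀ j, TA (j + 1) = ![0, 0, 0, 0, 1] + qA • TA j + qP • TP cR mA)
    (hrdep : 2 ≤ dep r) (j₀ NA NE NP NM : ℕ)
    (hroot : (∀ w ∈ GC r, (rk w = 3 ∧ ax w = j₀ ∧ 1 ≤ dep w) ∨ (dep w = 2 * mA + 2 ∧ rk w = 2) ∨ (dep w = 2 * mA + 1 ∧ rk w = 1 ∧ (cl w = 1 ∨ cl w = -1))) ∧
      {w | w ∈ GC r ∧ rk w = 3}.ncard = NA ∧ {w | w ∈ GC r ∧ rk w = 2}.ncard = NE ∧ {w | w ∈ GC r ∧ rk w = 1 ∧ cl w = 1}.ncard = NP ∧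
        {w | w ∈ GC r ∧ rk w = 1 ∧ cl w = -1}.ncard = NM) :
    (fun j => ({v | latticeGraphIso σ ϖ (Matrix.diagonal d) T v = v} ∩ {w | IsSelfDualLattice σ ϖ (Matrix.diagonal d) w.1 ∧ str j w}).ncard) =
      ![0, 0, 0, 0, 1] + NA • TA j₀ + NE • TE (mA + 1) + NP • TP 1 mA + NM • TP (-1) mA := by
  classical
  have hTree := isTree_latticeGraph_three_diagonal_of_neg hσ hvσ hϖ hσϖ hres h2 hnorm d hd hdσ
  exact strataVec_total_eq_of_localLaw_axis_of_root hTree r {v | latticeGraphIso σ ϖ (Matrix.diagonal d) T v = v}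
    (finite_setOf_latticeGraphIso_diagonal_eq hvσ hϖ hd (fun l => (hs l).le) hδ0 hδ T hT)
    (parentClosed_setOf_latticeGraphIso_diagonal_eq hTree T hT hs r hr) (fun v => IsSelfDualLattice σ ϖ (Matrix.diagonal d) v.1) str
    (fun v c hvc hv => not_isSelfDualLattice_of_adj_diagonal hσ hvσ hϖ hres h2 hnorm d hd hdσ v c hvc hv)
    (fun c w hcw hc => isSelfDualLattice_of_adj_of_not_diagonal hσ hvσ hϖ hres h2 hnorm d hd hdσ c w hcw hc)
    dep rk ax cl hstr GC hGC q sgn hrk hcl hodd hAdep hB hC hR hE hO hP mA qA qP NE₀ NP₀ NM₀ cR hAs hA0 TE TO TA TP hTE hTO0 hTOs hTP0 hTP0' hTPs hTA0 hTAs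
    (latticeGraphIso_diagonal_root_eq T hT hs r hr) (isSelfDualLattice_root_diagonal hϖ hd r hr) hrdep j₀ NA NE NP NM hroot

end Engine

end Literature.NumberTheory.Rogawski1990
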